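/-
HONEST FRAMING: certified error envelopes and provably optimal rounding/accumulation schemes for
low-precision formats under stated cost models; every table by two implementations; no hardware
or vendor claims.
-/
import Summits.Ventures.CertifiedArithmetic.LowPrec.OptDemotionRoutingE3
import Summits.Ventures.CertifiedArithmetic.LowPrec.OptDemotionRoutingR33Rows

/-!
# The demotion law (Theorem T8), part 10l-c: the popcount-3 `E`-rows at `ρ = u`, every level, every tree

By value, in the budget units of parts 9d/10e: for every `q ≥ 5`, every level `β = 2^k`
(`k + 2 ≤ q`), every three-bit offset `B = 2^i + 2^i' + 2^i'' < β` (`i'' < i' < i < k`) and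
every summation tree, `E(β, B, ρ = u): 2 BR_t(β + B) ≤ (1 - u) BR_t(2β + B) + (1 + u) BR_t(B + ½)`
(`eRow_threeBit`) — part 10l `treeBR_eRow3` at `j = k+1-i`, `k' = k+1-i'`, `l' = k+1-i''`, scaled
up by homogeneity and raised in its last coordinate by one (M) step, as parts 10c / 10j-c do for
popcount 1 / 2.  With `eRow_zero_u`, `eRow_singleBit`, `eRow_twoBit`: EVERY e-side row with
`popcount(B) ≤ 3` holds at `ρ = u` at every level, for every tree and every `q ≥ 5` — packaged as
`eRow_of_card_le_three` (`ERow q t u k (Σ_{i∈S} 2^i)` for any `S` of at most three positions below `k`).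
-/

namespace Summit.Ventures.CertifiedArithmetic.LowPrec.Opt

open Literature.ComputerArithmetic.JeannerodRump2018
open Literature.ComputerArithmetic.JeannerodRump2018.SumTree

section E3Rows

variable {q : ℕ}

/-- `val {a, b, c, d} = 2^a + 2^b + 2^c + 2^d` for distinct exponents. -/
theorem val_quad {a b c d : ℤ} (hab : a ≠ b) (hac : a ≠ c) (had : a ≠ d) (hbc : b ≠ c) (hbd : b ≠ d)
    (hcd : c ≠ d) :
    val ({a, b, c, d} : Finset ℤ) = (2 : ℚ) ^ a + (2 : ℚ) ^ b + (2 : ℚ) ^ c + (2 : ℚ) ^ d := by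
  rw [val_insert (by simp only [Finset.mem_insert, Finset.mem_singleton]; omega), val_triple hbc hbd hcd]
  ring

/-- The image of a four-bit configuration under a shift. -/
theorem image_quad_add (a b c d k : ℤ) :
    (({a, b, c, d} : Finset ℤ).image fun e => e + k) = ({a + k, b + k, c + k, d + k} : Finset ℤ) := by
  simp only [Finset.image_insert, Finset.image_singleton]

/-- **THE THREE-BIT `E`-ROWS AT `ρ = u`, EVERY LEVEL, EVERY TREE, EVERY `q ≥ 5`**: with `β = 2^k`
(`k + 2 ≤ q`), `B = 2^i + 2^i' + 2^i''` (`i'' < i' < i < k`) and `e = β + B`: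
`2 BR_t(e) ≤ (1 - u) BR_t(e + β) + (1 + u) BR_t(e - β + ½)`. -/
theorem treeBRv_eRow_threeBit (hq : 5 ≤ q) {k i i' i'' : ℕ} (hk : k + 2 ≤ q) (hik : i < k) (hii : i' < i)
    (hiii : i'' < i') (t : SumTree) :
    let β : ℚ := (2 : ℚ) ^ k
    let e : ℚ := β + ((2 ^ i + 2 ^ i' + 2 ^ i'' : ℕ) : ℚ)
    2 * treeBRv q t e ≤ (1 - unitRoundoff q) * treeBRv q t (e + β) +
      (1 + unitRoundoff q) * treeBRv q t (e - β + 1 / 2) := by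
  intro β e
  have hq1 : 1 ≤ q := by omega
  obtain ⟨j, hj⟩ : ∃ j : ℕ, j = k + 1 - i := ⟨_, rfl⟩
  obtain ⟨k', hk'⟩ : ∃ k' : ℕ, k' = k + 1 - i' := ⟨_, rfl⟩
  obtain ⟨l', hl'⟩ : ∃ l' : ℕ, l' = k + 1 - i'' := ⟨_, rfl⟩
  have hj2 : 2 ≤ j := by omega
  have hjk : j < k' := by omega
  have hkl : k' < l' := by omega
  have hlq : l' + 1 ≤ q := by omega
  have hjz : (j : ℤ) = (k : ℤ) + 1 - i := by omega
  have hkz : (k' : ℤ) = (k : ℤ) + 1 - i' := by omega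
  have hlz : (l' : ℤ) = (k : ℤ) + 1 - i'' := by omega
  have h := treeBR_eRow3 hq hj2 hjk hkl hlq t
  have s1 := treeBR_image_add (q := q) t ({0, -((j : ℤ) - 1), -((k' : ℤ) - 1), -((l' : ℤ) - 1)} : Finset ℤ) (k : ℤ)
  have s2 := treeBR_image_add (q := q) t ({0, -(j : ℤ), -(k' : ℤ), -(l' : ℤ)} : Finset ℤ) ((k : ℤ) + 1)
  have s3 := treeBR_image_add (q := q) t ({0, -((k' : ℤ) - j), -((l' : ℤ) - j), -((q : ℤ) - j)} : Finset ℤ) ((k : ℤ) + 1 - j)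
  rw [image_quad_add] at s1 s2 s3
  have i1 : ({0 + (k : ℤ), -((j : ℤ) - 1) + (k : ℤ), -((k' : ℤ) - 1) + (k : ℤ), -((l' : ℤ) - 1) + (k : ℤ)} : Finset ℤ) =
      {(k : ℤ), (i : ℤ), (i' : ℤ), (i'' : ℤ)} := by
    rw [hjz, hkz, hlz]; ext z; simp only [Finset.mem_insert, Finset.mem_singleton]; omega
  have i2 : ({0 + ((k : ℤ) + 1), -(j : ℤ) + ((k : ℤ) + 1), -(k' : ℤ) + ((k : ℤ) + 1), -(l' : ℤ) + ((k : ℤ) + 1)} : Finset ℤ) =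
      {(k : ℤ) + 1, (i : ℤ), (i' : ℤ), (i'' : ℤ)} := by
    rw [hjz, hkz, hlz]; ext z; simp only [Finset.mem_insert, Finset.mem_singleton]; omega
  have i3 : ({0 + ((k : ℤ) + 1 - j), -((k' : ℤ) - j) + ((k : ℤ) + 1 - j), -((l' : ℤ) - j) + ((k : ℤ) + 1 - j),
      -((q : ℤ) - j) + ((k : ℤ) + 1 - j)} : Finset ℤ) = {(i : ℤ), (i' : ℤ), (i'' : ℤ), (k : ℤ) + 1 - q} := by
    rw [hjz, hkz, hlz]; ext z; simp only [Finset.mem_insert, Finset.mem_singleton]; omega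
  rw [i1] at s1
  rw [i2] at s2
  rw [i3] at s3
  -- (M): BR{i, i', i'', k+1-q} ≤ BR{i, i', i'', -1}
  have hM : treeBR q t {(i : ℤ), (i' : ℤ), (i'' : ℤ), (k : ℤ) + 1 - q} ≤ treeBR q t {(i : ℤ), (i' : ℤ), (i'' : ℤ), -1} := by
    refine treeBR_mono hq1 t (Finset.insert_nonempty _ _) (Finset.insert_nonempty _ _) ?_ ?_ ?_
    · intro a ha b hb
      simp only [Finset.mem_insert, Finset.mem_singleton] at ha hb
      rcases ha with rfl | rfl | rfl | rfl <;> rcases hb with rfl | rfl | rfl | rfl <;> omega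
    · intro a ha b hb
      simp only [Finset.mem_insert, Finset.mem_singleton] at ha hb
      rcases ha with rfl | rfl | rfl | rfl <;> rcases hb with rfl | rfl | rfl | rfl <;> omega
    · rw [val_quad (by omega) (by omega) (by omega) (by omega) (by omega) (by omega),
        val_quad (by omega) (by omega) (by omega) (by omega) (by omega) (by omega)]
      have : (2 : ℚ) ^ ((k : ℤ) + 1 - q) ≤ (2 : ℚ) ^ (-1 : ℤ) :=
        zpow_le_zpow_right₀ (by norm_num) (by omega)
      linarith
  -- the three values
  have hβ : β = (2 : ℚ) ^ (k : ℤ) := (zpow_natCast 2 k).symm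
  have hB : ((2 ^ i + 2 ^ i' + 2 ^ i'' : ℕ) : ℚ) = (2 : ℚ) ^ (i : ℤ) + (2 : ℚ) ^ (i' : ℤ) + (2 : ℚ) ^ (i'' : ℤ) := by
    push_cast; rw [← zpow_natCast 2 i, ← zpow_natCast 2 i', ← zpow_natCast 2 i'']
  have he : e = val ({(k : ℤ), (i : ℤ), (i' : ℤ), (i'' : ℤ)} : Finset ℤ) := by
    rw [val_quad (by omega) (by omega) (by omega) (by omega) (by omega) (by omega)]
    show β + _ = _; rw [hβ, hB]; ring
  have he1 : e + β = val ({(k : ℤ) + 1, (i : ℤ), (i' : ℤ), (i'' : ℤ)} : Finset ℤ) := by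
    rw [val_quad (by omega) (by omega) (by omega) (by omega) (by omega) (by omega), he,
      val_quad (by omega) (by omega) (by omega) (by omega) (by omega) (by omega), hβ,
      zpow_add_one₀ (by norm_num : (2 : ℚ) ≠ 0)]
    ring
  have he2 : e - β + 1 / 2 = val ({(i : ℤ), (i' : ℤ), (i'' : ℤ), -1} : Finset ℤ) := by
    rw [val_quad (by omega) (by omega) (by omega) (by omega) (by omega) (by omega), he,
      val_quad (by omega) (by omega) (by omega) (by omega) (by omega) (by omega), hβ, zpow_neg_one]
    ring
  rw [he1, he2, he, treeBRv_val, treeBRv_val, treeBRv_val, s1, s2]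
  have hpos : 0 < (2 : ℚ) ^ (k : ℤ) := zpow_pos (by norm_num) _
  have hu1 : 0 ≤ 1 + unitRoundoff q := by linarith [unitRoundoff_nonneg q]
  have hu1' : 0 ≤ 1 - unitRoundoff q := by linarith [unitRoundoff_le_one q]
  have h' := mul_le_mul_of_nonneg_left h hpos.le
  have hM' := mul_le_mul_of_nonneg_left (mul_le_mul_of_nonneg_left hM hu1) hpos.le
  rw [s3] at hM'
  have p1 : (2 : ℚ) ^ ((k : ℤ) + 1) = 2 * (2 : ℚ) ^ (k : ℤ) := by
    rw [zpow_add_one₀ (by norm_num)]; ring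
  have p2 : (2 : ℚ) ^ ((k : ℤ) + 1 - j) = 2 * (2 : ℚ) ^ (k : ℤ) * (2 : ℚ) ^ (-(j : ℤ)) := by
    rw [← p1, ← zpow_add₀ (by norm_num)]; congr 1
  rw [p1]
  rw [p2] at hM'
  nlinarith [h', hM', hpos, mul_nonneg hu1' (treeBR_nonneg q t {0, -(j : ℤ), -(k' : ℤ), -(l' : ℤ)}),
    mul_nonneg hu1 (treeBR_nonneg q t {0, -((k' : ℤ) - j), -((l' : ℤ) - j), -((q : ℤ) - j)})]

/-- **THE THREE-BIT ROWS `E(2^k, 2^i + 2^i' + 2^i'', u)`**, `i'' < i' < i < k ≤ q - 2`, for every tree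
(R34 for popcount 3). -/
theorem eRow_threeBit (hq : 5 ≤ q) (t : SumTree) {k i i' i'' : ℕ} (hk : k + 2 ≤ q) (hik : i < k)
    (hii : i' < i) (hiii : i'' < i') :
    ERow q t (unitRoundoff q) k (2 ^ i + 2 ^ i' + 2 ^ i'') := by
  have h := treeBRv_eRow_threeBit hq hk hik hii hiii t
  unfold ERow
  simpa using h

/-- **EVERY `E`-ROW WITH `popcount(B) ≤ 3` AT `ρ = u`** (packaging of parts 10e `eRow_zero_u`, 10c
`eRow_singleBit`, 10j-c `eRow_twoBit`, 10l-c `eRow_threeBit`): for `q ≥ 5`, a level `k + 2 ≤ q`,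
any set `S` of at most three bit positions below `k` and every tree, `ERow q t u k (Σ_{i ∈ S} 2^i)`. -/
theorem eRow_of_card_le_three (hq : 5 ≤ q) (t : SumTree) {k : ℕ} (hk : k + 2 ≤ q) (S : Finset ℕ)
    (hS : ∀ i ∈ S, i < k) (h3 : S.card ≤ 3) :
    ERow q t (unitRoundoff q) k (∑ i ∈ S, 2 ^ i) := by
  obtain ⟨n, hn⟩ : ∃ n, S.card = n := ⟨_, rfl⟩
  have hn3 : n ≤ 3 := hn ▸ h3
  rcases n with _ | n
  · rw [Finset.card_eq_zero] at hn
    subst hn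
    simpa using eRow_zero_u (by omega : 1 ≤ q) t hk
  rcases n with _ | n
  · obtain ⟨a, rfl⟩ := Finset.card_eq_one.1 (by simpa using hn)
    rw [Finset.sum_singleton]
    exact eRow_singleBit (by omega) t hk (hS a (Finset.mem_singleton_self a))
  rcases n with _ | n
  · obtain ⟨x, y, hxy, rfl⟩ := Finset.card_eq_two.1 (by simpa using hn)
    rw [Finset.sum_pair hxy]
    have hx := hS x (by simp)
    have hy := hS y (by simp)
    rcases lt_or_gt_of_ne hxy with h | h
    · rw [add_comm]; exact eRow_twoBit (by omega) t hk hy h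
    · exact eRow_twoBit (by omega) t hk hx h
  rcases n with _ | n
  · obtain ⟨x, y, z, hxy, hxz, hyz, rfl⟩ := Finset.card_eq_three.1 (by simpa using hn)
    have hx := hS x (by simp)
    have hy := hS y (by simp)
    have hz := hS z (by simp)
    rw [Finset.sum_insert (by simp only [Finset.mem_insert, Finset.mem_singleton]; omega), Finset.sum_pair hyz]
    -- sort the three positions
    have key : ∀ a b c : ℕ, a < k → b < a → c < b → ({a, b, c} : Finset ℕ) = {x, y, z} →
        ERow q t (unitRoundoff q) k (2 ^ x + (2 ^ y + 2 ^ z)) := by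
      intro a b c ha hab hbc habc
      have h := eRow_threeBit hq t hk ha hab hbc
      have hs : (2 : ℕ) ^ a + 2 ^ b + 2 ^ c = 2 ^ x + (2 ^ y + 2 ^ z) := by
        have e1 : ∑ i ∈ ({a, b, c} : Finset ℕ), 2 ^ i = 2 ^ a + 2 ^ b + 2 ^ c := by
          rw [Finset.sum_insert (by simp only [Finset.mem_insert, Finset.mem_singleton]; omega),
            Finset.sum_pair (by omega)]; ring
        have e2 : ∑ i ∈ ({x, y, z} : Finset ℕ), 2 ^ i = 2 ^ x + (2 ^ y + 2 ^ z) := by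
          rw [Finset.sum_insert (by simp only [Finset.mem_insert, Finset.mem_singleton]; omega),
            Finset.sum_pair hyz]
        rw [← e1, ← e2, habc]
      rw [hs] at h; exact h
    rcases lt_or_gt_of_ne hxy with h1 | h1 <;> rcases lt_or_gt_of_ne hyz with h2 | h2 <;>
      rcases lt_or_gt_of_ne hxz with h3 | h3
    · exact key z y x hz h2 h1 (by ext w; simp only [Finset.mem_insert, Finset.mem_singleton]; omega)
    · omega
    · exact key y z x hy h2 h3 (by ext w; simp only [Finset.mem_insert, Finset.mem_singleton]; omega)
    · exact key y x z hy h1 h3 (by ext w; simp only [Finset.mem_insert, Finset.mem_singleton]; omega)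
    · exact key z x y hz h3 h1 (by ext w; simp only [Finset.mem_insert, Finset.mem_singleton]; omega)
    · exact key x z y hx h3 h2 (by ext w; simp only [Finset.mem_insert, Finset.mem_singleton]; omega)
    · omega
    · exact key x y z hx h1 h2 rfl
  · omega

end E3Rows

end Summit.Ventures.CertifiedArithmetic.LowPrec.Opt
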